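/-
Copyright: the b2b-balaban cell (near-miss cell 7), T⁴-continuum fan-out; row NE7b ROUND-2 swarm, seat
t4-ne7b-formalise-leaf-10 (row S7 §0 of `t4/b2b-balaban-t4-ne7b-p1/LEAVES-NE7b.md`, owner's ruling R-OWNER-22-1 R2).
Released under the licence of the surrounding project.
-/
import Summits.QuantumFields.BalabanUV.T4Continuum.Support.HistorySocketTH

/-!
# The tree-count socket ALONG BAŁABAN'S TUNED RUNS (companion of `Support/HistorySocketTH`)

Summits-side support leaf of the T⁴-continuum cell (rung (B)+1 on a FINITE torus only; NOT infinite volume, NOT the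
mass gap, NOT the Clay statement; NOT a proof of the spine estimate NE7b).  Row NE7b, route «COUNT», claim table
`t4/b2b-balaban-t4-ne7b-p1/LEAVES-NE7b.md` row S7 §0 (owner's ruling R-OWNER-22-1 R2: «the `_tuned` twins importing
`HistoryFlow.flowBinders_of_tuned` ∕ `hir_of_tuned`»), seat `t4-ne7b-formalise-leaf-10`.  [folklore] composition BY NAME
of the landed `HistoryFlow` (S8, p207273: the typed-flow binders along the tuned runs) with
`HistorySocketTH.relWeightBound_of_liveHistoriesTH` ∕ `hybridNE7_of_liveHistoriesTH`; nothing printed asserted, no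
`[cite:]` tag, no `Prop` fact minted.

WHAT.  **`relWeightBound_of_liveHistoriesTH_tuned`** ∕ **`hybridNE7_of_liveHistoriesTH_tuned`**: the TH exit ∕ the seam
over the socket for the coupling family `g K := (D.C ⟨K, F.m, g₀ K⟩).flow.g` of a `FiniteEpsData` along bare couplings
tuned to `g` within `]0, γ]`, with `h27 h29 hx1 hir` REPLACED by box β-bounds (⇐ `BetaPertHyp`, `HistoryFlow` §3∕§6),
`γ ≤ γ₀`, `γ²β′ < 1`, `SmallnessFor γ β′ β₀ F.L p` (`p ≥ C.p₀, rr`), tuning, and the infrared smallness of the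
RENORMALISED coupling `irThresholdTH … ≤ log g⁻²`.  Displayed, as in the exit: the (2.5) side condition `hR` of the size
function and the TH exit's `hP : 0 ≤ p₀(g_{K,s})` for all `s` (dischargeable by clamping `s ↦ min s K` under `hx1`, or
from `g_{K,s} ≤ 1`; not done here).  §2 sanity: the socket with no bad class is inhabited (every field vacuous).

HONEST DEPENDENCY (cell): continuum YM on T⁴ ⇐ BetaPertH ∧ nine spine estimates (0/9 proved); BetaPertH ⇐ (D1) ∧ (D4)
∧ CAP+tail.  This file changes none of it.  NE7b NOT proved.
-/

open Finset
open Literature.MathematicalPhysics.QuantumFieldTheory.Balaban1983to89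
open T4PersistenceDictionary T4PersistentHistoryCount T4BankedInduction T4PrintedShapeBanking T4WeightBudget
open T4GlobalDenominator T4LiveClassFibration T4LiveStructureGas T4LiveGasToTerms T4RecordPriceSeam T4IndicatorShell
open T4MatchingAssembly T4MatchingClosure T4MatchingClosureSocket T4PartnerMultiplicity T4Continuum
open T4BranchingRecordsGas T4TaggedShapeBanking T4CanonicalMenus T4CountHorizon
open Summit.QuantumFields.BalabanUV.T4Continuum.CountThresholdUniform
open Summit.QuantumFields.BalabanUV.T4Continuum.CountThresholdExit
open Summit.QuantumFields.BalabanUV.T4Continuum.CountSeamJunction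
open Summit.QuantumFields.BalabanUV.T4Continuum.LateMergers
open Summit.QuantumFields.BalabanUV.T4Continuum.HistoryFlow
open Summit.QuantumFields.BalabanUV.T4Continuum.HistorySocketTH

namespace Summit.QuantumFields.BalabanUV.T4Continuum.HistorySocketTHTuned

noncomputable section

/-! ## §1 Along Bałaban's tuned runs (the flow side from S8 `HistoryFlow`) -/

section Tuned

variable {F : T4Family} {G : Type*} [GaugeGroup G] [MeasurableSpace G] [HaarData G]
variable {ε γc κ ι : Type*} [DecidableEq ε] [DecidableEq γc] [DecidableEq κ] [DecidableEq ι] {l₀ vol : ℝ} {K₀ : ℕ}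
  {π : ℕ → ι → κ} {T : ℕ → Finset ι} {A A' shA shB : ℕ → ℝ → ι → ℝ} {Bad' : ℕ → ℝ → Finset κ}
  {dead dead' : ℕ → ℝ → ι → ℝ} {Fc Rf Fc' Rf' : ℕ → κ → ℝ} {nlow nup mlow mup : ℕ → ℝ → ℝ} {Cn : ℝ}
  {Cc Rr CcRec RrRec : ℕ → ℝ → ι → ℝ} {ν u s₂ c₀ r s Wsh : ℕ → ℝ}

omit [DecidableEq ι] in
/-- **THE TREE-COUNT EXIT OVER THE SOCKET, ALONG THE TUNED RUNS** `g K := (D.C ⟨K, F.m, g₀ K⟩).flow.g`: the flow binders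
`h27 h29 hx1 hir` REPLACED by box β-bounds (⇐ `BetaPertHyp`, `HistoryFlow` §3), `γ ≤ γ₀`, `γ²β′ < 1`,
`SmallnessFor γ β′ β₀ F.L p` (`p ≥ C.p₀, rr`), tuning, and the infrared smallness of the RENORMALISED coupling
`irThresholdTH … ≤ log g⁻²`; `hR` ((2.5) side condition) and `hP` (`0 ≤ p₀(g_{K,s})`) stay displayed. [folklore] -/
theorem relWeightBound_of_liveHistoriesTH_tuned (Dd : FiniteEpsData F G) (sh : ε → PEv)
    {C : T4PrintedShapeBanking.Consts} {rr : ℕ} {β₀ : ℝ} (h : ThresholdOK C F.L rr β₀) (hμ₀ : 0 < C.μ)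
    {γ₀ γ b β' gc : ℝ} {p : ℕ} (hb : 0 ≤ b) (hlo : FlowStep.BetaLowerH b γ₀ Dd.βfun)
    (hhi : FlowStep.BetaUpperH β' γ₀ Dd.βfun) (hγ : γ ≤ γ₀) (hγβ : γ ^ 2 * β' < 1)
    (S : B14FlowStep.SmallnessFor γ β' β₀ F.L p) (hp₀ : C.p₀ ≤ p) (hrr : rr ≤ p)
    {g₀ : ℕ → ℝ} (ht : Dd.Tuned γ gc g₀)
    (Cell : ℕ → ℕ → Finset γc) {V Λ : ℝ} (hV : 0 ≤ V) (hΛ : 0 < Λ)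
    (hcell : ∀ K a, ((Cell K a).card : ℝ) ≤ V * Λ ^ a) (Dcap Ncap : ℕ → ℕ)
    (jstar : ℕ → ℕ) (hj : ∀ K, jstar K ≤ K) {c : ℝ} (hc : 0 < c)
    (hfrac : ∀ K : ℕ, c * K ≤ ((K - jstar K : ℕ) : ℝ)) (D : ℕ) {Δ : ℝ} (hΔ : 1 ≤ Δ)
    (hir : irThresholdTH sh C F.L rr β₀ D ≤ Real.log (gc ^ 2)⁻¹)
    (hA : Regeneration l₀ π T A Bad' dead Fc Rf nlow nup Cn K₀)
    (hA' : Regeneration l₀ π T A' Bad' dead' Fc' Rf' mlow mup Cn K₀) (hCn : 0 ≤ Cn)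
    (R : ℕ → ℕ → ℕ) (hR : ∀ K s, s ≤ K → B14.IsRj F.L rr ((Dd.C ⟨K, F.m, g₀ K⟩).flow.g s) (R K s))
    (hP : ∀ K s, 0 ≤ p0Profile C.A₀ C.p₀ ((Dd.C ⟨K, F.m, g₀ K⟩).flow.g s))
    {ηplus : ℝ} (hηplus : 0 ≤ ηplus) (hr : Λ * Real.exp (ηplus - C.κ₁) < 1)
    {Λ' : ℝ} (hΛ0 : 0 ≤ Λ') (h1 : Λ' * Real.exp (-C.κ₁) * Real.exp ηplus < 1)
    (hx : (Real.exp (-C.E₀) + Real.exp (-C.E₀) * birthMass C *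
          (Λ' * Real.exp (-C.κ₁) / (1 - Λ' * Real.exp (-C.κ₁) * Real.exp ηplus))) * Real.exp ηplus ≤
        Real.exp ηplus - 1)
    {live : ℕ → κ → Finset (γc × Gen ε)}
    (H : LiveHistoriesTH sh C Λ' Δ l₀ K₀ R (fun K => (Dd.C ⟨K, F.m, g₀ K⟩).flow.g) Cell Dcap Ncap jstar D Bad' Fc Rf
      Fc' Rf' live) :
    ∃ K₁, K₀ ≤ K₁ ∧ RelWeightBound l₀ T A A' (fun K t => if K₁ ≤ K then badOfClass π T Bad' K t else ∅)
      (Set.indicator {K | K₁ ≤ K}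
        (fun K => Cn * recordsBudget (Δ * Real.exp (C.κ₁ * (D : ℝ)) * birthMass C) C.κ₁ V Λ ηplus jstar K)) := by
  obtain ⟨h27, h29, hx1, -⟩ := flowBinders_of_tuned Dd hb hlo hhi hγ hγβ S hp₀ hrr ht R hR
  exact relWeightBound_of_liveHistoriesTH sh h hμ₀ Cell hV hΛ hcell Dcap Ncap jstar hj hc hfrac D hΔ hA hA' hCn R
    (fun K => (Dd.C ⟨K, F.m, g₀ K⟩).flow.g) (fun _ => β') (fun K _ => h27 K) (fun K _ => h29 K)
    (fun K _ s hs => hR K s hs) (fun K _ s hs => hx1 K s hs) (fun K _ => hir_of_tuned Dd ht hir K) hP hηplus hr hΛ0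
    h1 hx H

/-- **… AND INTO THE SEAM, ALONG THE TUNED RUNS.** [folklore] -/
theorem hybridNE7_of_liveHistoriesTH_tuned (Dd : FiniteEpsData F G) (sh : ε → PEv)
    {C : T4PrintedShapeBanking.Consts} {rr : ℕ} {β₀ : ℝ} (h : ThresholdOK C F.L rr β₀) (hμ₀ : 0 < C.μ)
    {γ₀ γ b β' gc : ℝ} {p : ℕ} (hb : 0 ≤ b) (hlo : FlowStep.BetaLowerH b γ₀ Dd.βfun)
    (hhi : FlowStep.BetaUpperH β' γ₀ Dd.βfun) (hγ : γ ≤ γ₀) (hγβ : γ ^ 2 * β' < 1)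
    (S : B14FlowStep.SmallnessFor γ β' β₀ F.L p) (hp₀ : C.p₀ ≤ p) (hrr : rr ≤ p)
    {g₀ : ℕ → ℝ} (ht : Dd.Tuned γ gc g₀)
    (Cell : ℕ → ℕ → Finset γc) {V Λ : ℝ} (hV : 0 ≤ V) (hΛ : 0 < Λ)
    (hcell : ∀ K a, ((Cell K a).card : ℝ) ≤ V * Λ ^ a) (Dcap Ncap : ℕ → ℕ)
    (jstar : ℕ → ℕ) (hj : ∀ K, jstar K ≤ K) {c : ℝ} (hc : 0 < c)
    (hfrac : ∀ K : ℕ, c * K ≤ ((K - jstar K : ℕ) : ℝ)) (D : ℕ) {Δ : ℝ} (hΔ : 1 ≤ Δ)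
    (hir : irThresholdTH sh C F.L rr β₀ D ≤ Real.log (gc ^ 2)⁻¹)
    (hA : Regeneration l₀ π T A Bad' dead Fc Rf nlow nup Cn K₀)
    (hA' : Regeneration l₀ π T A' Bad' dead' Fc' Rf' mlow mup Cn K₀) (hCn : 0 ≤ Cn)
    (R : ℕ → ℕ → ℕ) (hR : ∀ K s, s ≤ K → B14.IsRj F.L rr ((Dd.C ⟨K, F.m, g₀ K⟩).flow.g s) (R K s))
    (hP : ∀ K s, 0 ≤ p0Profile C.A₀ C.p₀ ((Dd.C ⟨K, F.m, g₀ K⟩).flow.g s))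
    {ηplus : ℝ} (hηplus : 0 ≤ ηplus) (hr : Λ * Real.exp (ηplus - C.κ₁) < 1)
    {Λ' : ℝ} (hΛ0 : 0 ≤ Λ') (h1 : Λ' * Real.exp (-C.κ₁) * Real.exp ηplus < 1)
    (hx : (Real.exp (-C.E₀) + Real.exp (-C.E₀) * birthMass C *
          (Λ' * Real.exp (-C.κ₁) / (1 - Λ' * Real.exp (-C.κ₁) * Real.exp ηplus))) * Real.exp ηplus ≤
        Real.exp ηplus - 1)
    {live : ℕ → κ → Finset (γc × Gen ε)}
    (H : LiveHistoriesTH sh C Λ' Δ l₀ K₀ R (fun K => (Dd.C ⟨K, F.m, g₀ K⟩).flow.g) Cell Dcap Ncap jstar D Bad' Fc Rf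
      Fc' Rf' live)
    (hSh : ShellWeightBound l₀ T A A' shA shB Wsh)
    (hTB : ReindexedBudget l₀ vol T (fun K t τ => A K t τ - shA K t τ) (fun K t τ => A' K t τ - shB K t τ)
      (badOfClass π T Bad') Cc Rr CcRec RrRec ν u s₂ c₀ r s)
    (hrs : Summable r) (hu : Summable u) (hs : Summable s) (hs₂ : Summable s₂) :
    ∃ K₁ K₂, K₀ ≤ K₁ ∧ HybridNE7 l₀ vol (fun K => T (K₁ + (K₂ + K))) (fun K => A (K₁ + (K₂ + K)))
      (fun K => A' (K₁ + (K₂ + K))) (fun K => badOfClass π T Bad' (K₁ + (K₂ + K)))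
      (fun K => Cn * recordsBudget (Δ * Real.exp (C.κ₁ * (D : ℝ)) * birthMass C) C.κ₁ V Λ ηplus jstar
        (K₁ + (K₂ + K)))
      (fun K => shA (K₁ + (K₂ + K))) (fun K => shB (K₁ + (K₂ + K))) (fun K => Wsh (K₁ + (K₂ + K)))
      (fun K => (r (K₁ + (K₂ + K)) + u (K₁ + (K₂ + K))) + (s (K₁ + (K₂ + K)) + s₂ (K₁ + (K₂ + K)))) :=
  hybridNE7_of_eventually
    (relWeightBound_of_liveHistoriesTH_tuned Dd sh h hμ₀ hb hlo hhi hγ hγβ S hp₀ hrr ht Cell hV hΛ hcell Dcap Ncap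
      jstar hj hc hfrac D hΔ hir hA hA' hCn R hR hP hηplus hr hΛ0 h1 hx H)
    hSh hTB hrs hu hs hs₂

end Tuned


/-! ## §2 Sanity: the socket with no bad class -/

namespace Sanity

/-- With EMPTY bad classes every field of `LiveHistoriesTH` holds for the empty live families. [folklore] -/
example (C : T4PrintedShapeBanking.Consts) (Λ' Δ l₀ : ℝ) (K₀ : ℕ) (R : ℕ → ℕ → ℕ) (g : ℕ → ℕ → ℝ)
    (Cell : ℕ → ℕ → Finset ℕ) (Dcap Ncap jstar : ℕ → ℕ) (D : ℕ) (F Rf F' Rf' : ℕ → Unit → ℝ) :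
    LiveHistoriesTH (id : PEv → PEv) C Λ' Δ l₀ K₀ R g Cell Dcap Ncap jstar D (fun _ _ => (∅ : Finset Unit)) F Rf F' Rf'
      (fun _ _ => (∅ : Finset (ℕ × Gen PEv))) where
  consistent K q _ h := by obtain ⟨t, -, c, hc, -⟩ := h; simp at hc
  fresh K q _ h := by obtain ⟨t, -, c, hc, -⟩ := h; simp at hc
  pending K q _ h := by obtain ⟨t, -, c, hc, -⟩ := h; simp at hc
  cell_mem K q _ h := by obtain ⟨t, -, c, hc, -⟩ := h; simp at hc
  canon K q _ h := by obtain ⟨t, -, c, hc, -⟩ := h; simp at hc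
  old K t _ _ c hc := by simp at hc
  slot_inj K t _ _ c hc := by simp at hc
  str_inj K t _ _ := by simp
  price K t _ _ c hc := by simp at hc
  price' K t _ _ c hc := by simp at hc

end Sanity

end

end Summit.QuantumFields.BalabanUV.T4Continuum.HistorySocketTHTuned
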